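import Mathlib
import Summits.CriticalPhenomena.CardyFormulaZ2.Theorems.CardyMagicRigidityNestingRigidityTameRigidityArcs
import Summits.CriticalPhenomena.CardyFormulaZ2.Theorems.CardyMagicRigidityNestingRigidityTameRigidityGeometry
import HarnessLib

/-!
# `tame_rigidity` is false, III: the two-mouth-lake loop has at most double points

Crux `Summit.CriticalPhenomena.CardyFormulaZ2.Theses.CardyMagicRigidity.NestingRigidity`
(stmt-CriticalPhenomena-4835), line `positive-cone-weight-doubling`, refutation of the registered helper
`tame_rigidity` (third brick; after `…TameRigidityArcs` p131776, `…TameRigidityGeometry` p131987).  For the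
loop `L = U · D · d · b · a · c : Path 2 2` of `…TameRigidityArcs` (time slots `[0,¼] (¼,½] (½,⅝] (⅝,¾] (¾,⅞]
(⅞,1]` of Mathlib's `Path.trans`) we prove the `Tame.atMostDouble` clause: among three times `< 1` with the
same image, two coincide (`TwoMouth.atMostDouble_loop`).  The preimages in `[0,1)` of the tangency points are
`L⁻¹{2} = {0, ½}`, `L⁻¹{−2} = {¼, ¾}`, `L⁻¹{0} = {⅝, ⅞}`; every other point of the trace lies on exactly one
of the three circles, and `L` is injective on the time set of each circle minus those points (`[0,½)`: the big
circle by the angle `4πt`; `(⅝,⅞]`: the left lake boundary by an angle in `[−π, π)`; `(½,⅝] ∪ (⅞,1)`: the right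
one), by `eq_of_circleMap_eq`.  Anchor: `exists_twoMouthLoop_atMostDouble`.
-/

noncomputable section

open Set Metric Complex
open scoped Real

namespace Summit.CriticalPhenomena.CardyFormulaZ2.Cruxes.NestingRigidity.PositiveConeWeightDoubling

open Literature.Probability.RandomPlanarGeometry

namespace TwoMouth

section Loop

variable {U : Path (2 : ℂ) (-2)} {D : Path (-2 : ℂ) 2} {a : Path (-2 : ℂ) 0} {b : Path (0 : ℂ) (-2)}
  {c : Path (0 : ℂ) 2} {d : Path (2 : ℂ) 0}

/-! ## §1 The loop slot by slot -/

/-- On `[0, ½]` the loop runs once around the big circle: `L t = circleMap 0 2 (4πt)`. -/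
theorem loop_apply_big (hU : ∀ t, U t = circleMap 0 2 (0 + (π - 0) * t)) (hD : ∀ t, D t = circleMap 0 2 (π + (2 * π - π) * t)) {t : unitInterval} (ht : (t : ℝ) ≤ 1 / 2) :
    ((U.trans D).trans ((d.trans b).trans (a.trans c))) t = circleMap 0 2 (4 * π * t) := by
  rw [Path.trans_apply, dif_pos ht, trans_big hU hD]
  congr 1
  push_cast
  ring

/-- On `(½, ⅝]`: the lower half `d` of the right lake boundary, `L t = circleMap 1 1 (−π(8t − 4))`. -/
theorem loop_apply_d (hd : ∀ t, d t = circleMap 1 1 (0 + (-π - 0) * t)) {t : unitInterval} (ht : 1 / 2 < (t : ℝ)) (ht' : (t : ℝ) ≤ 5 / 8) :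
    ((U.trans D).trans ((d.trans b).trans (a.trans c))) t = circleMap 1 1 (-(π * (8 * t - 4))) := by
  rw [Path.trans_apply, dif_neg (not_le.2 ht), Path.trans_apply,
    dif_pos (show (2 * (t : ℝ) - 1) ≤ 1 / 2 by linarith), Path.trans_apply,
    dif_pos (show (2 * (2 * (t : ℝ) - 1)) ≤ 1 / 2 by linarith), hd]
  congr 1
  push_cast
  ring

/-- On `(⅝, ¾]`: the lower half `b` of the left lake boundary, `L t = circleMap (−1) 1 (−π(8t − 5))`. -/
theorem loop_apply_b (hb : ∀ t, b t = circleMap (-1) 1 (0 + (-π - 0) * t)) {t : unitInterval} (ht : 5 / 8 < (t : ℝ)) (ht' : (t : ℝ) ≤ 3 / 4) :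
    ((U.trans D).trans ((d.trans b).trans (a.trans c))) t = circleMap (-1) 1 (-(π * (8 * t - 5))) := by
  rw [Path.trans_apply, dif_neg (show ¬ (t : ℝ) ≤ 1 / 2 by linarith), Path.trans_apply,
    dif_pos (show (2 * (t : ℝ) - 1) ≤ 1 / 2 by linarith), Path.trans_apply,
    dif_neg (show ¬ (2 * (2 * (t : ℝ) - 1)) ≤ 1 / 2 by linarith), hb]
  congr 1
  push_cast
  ring

/-- On `(¾, ⅞]`: the upper half `a` of the left lake boundary, `L t = circleMap (−1) 1 (π − π(8t − 6))`. -/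
theorem loop_apply_a (ha : ∀ t, a t = circleMap (-1) 1 (π + (0 - π) * t)) {t : unitInterval} (ht : 3 / 4 < (t : ℝ)) (ht' : (t : ℝ) ≤ 7 / 8) :
    ((U.trans D).trans ((d.trans b).trans (a.trans c))) t = circleMap (-1) 1 (π - π * (8 * t - 6)) := by
  rw [Path.trans_apply, dif_neg (show ¬ (t : ℝ) ≤ 1 / 2 by linarith), Path.trans_apply,
    dif_neg (show ¬ (2 * (t : ℝ) - 1) ≤ 1 / 2 by linarith), Path.trans_apply,
    dif_pos (show (2 * (2 * (t : ℝ) - 1) - 1) ≤ 1 / 2 by linarith), ha]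
  congr 1
  push_cast
  ring

/-- On `(⅞, 1]`: the upper half `c` of the right lake boundary, `L t = circleMap 1 1 (π − π(8t − 7))`. -/
theorem loop_apply_c (hc : ∀ t, c t = circleMap 1 1 (π + (0 - π) * t)) {t : unitInterval} (ht : 7 / 8 < (t : ℝ)) :
    ((U.trans D).trans ((d.trans b).trans (a.trans c))) t = circleMap 1 1 (π - π * (8 * t - 7)) := by
  rw [Path.trans_apply, dif_neg (show ¬ (t : ℝ) ≤ 1 / 2 by linarith), Path.trans_apply,
    dif_neg (show ¬ (2 * (t : ℝ) - 1) ≤ 1 / 2 by linarith), Path.trans_apply,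
    dif_neg (show ¬ (2 * (2 * (t : ℝ) - 1) - 1) ≤ 1 / 2 by linarith), hc]
  congr 1
  push_cast
  ring

/-! ## §2 Which circle a slot lies on; tangency points in coordinates -/

/-- On `[0, ½]`, `|L t| = 2`. -/
theorem norm_loop_big (hU : ∀ t, U t = circleMap 0 2 (0 + (π - 0) * t)) (hD : ∀ t, D t = circleMap 0 2 (π + (2 * π - π) * t)) {t : unitInterval} (ht : (t : ℝ) ≤ 1 / 2) : ‖((U.trans D).trans ((d.trans b).trans (a.trans c))) t‖ = 2 := by
  rw [loop_apply_big hU hD ht, ← sub_zero (circleMap 0 2 _), circleMap_sub_center, norm_circleMap_zero]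
  norm_num

/-- On `(½, ⅝] ∪ (⅞, 1]`, `|L t − 1| = 1`. -/
theorem norm_loop_right (hc : ∀ t, c t = circleMap 1 1 (π + (0 - π) * t)) (hd : ∀ t, d t = circleMap 1 1 (0 + (-π - 0) * t)) {t : unitInterval}
    (ht : (1 / 2 < (t : ℝ) ∧ (t : ℝ) ≤ 5 / 8) ∨ 7 / 8 < (t : ℝ)) : ‖((U.trans D).trans ((d.trans b).trans (a.trans c))) t - 1‖ = 1 := by
  rcases ht with ⟨h₁, h₂⟩ | h
  · rw [loop_apply_d hd h₁ h₂, circleMap_sub_center, norm_circleMap_zero, abs_one]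
  · rw [loop_apply_c hc h, circleMap_sub_center, norm_circleMap_zero, abs_one]

/-- On `(⅝, ⅞]`, `|L t + 1| = 1`. -/
theorem norm_loop_left (ha : ∀ t, a t = circleMap (-1) 1 (π + (0 - π) * t)) (hb : ∀ t, b t = circleMap (-1) 1 (0 + (-π - 0) * t)) {t : unitInterval} (ht : 5 / 8 < (t : ℝ)) (ht' : (t : ℝ) ≤ 7 / 8) :
    ‖((U.trans D).trans ((d.trans b).trans (a.trans c))) t + 1‖ = 1 := by
  by_cases h : (t : ℝ) ≤ 3 / 4
  · rw [loop_apply_b hb ht h, ← sub_neg_eq_add, circleMap_sub_center, norm_circleMap_zero, abs_one]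
  · rw [loop_apply_a ha (not_le.1 h) ht', ← sub_neg_eq_add, circleMap_sub_center, norm_circleMap_zero, abs_one]

/-- The right lake boundary meets the big circle only at `2`. -/
theorem eq_two_of_norms {w : ℂ} (h₁ : ‖w - 1‖ = 1) (h₂ : ‖w‖ = 2) : w = 2 := by
  rw [norm_eq_one_iff', sub_re, sub_im, one_re, one_im, sub_zero] at h₁
  rw [norm_eq_two_iff] at h₂
  have hre : w.re = 2 := by nlinarith
  have him : w.im = 0 := by nlinarith [sq_nonneg w.im]
  rw [eq_of_re_im hre him]; norm_num

/-- The left lake boundary meets the big circle only at `−2`. -/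
theorem eq_neg_two_of_norms {w : ℂ} (h₁ : ‖w + 1‖ = 1) (h₂ : ‖w‖ = 2) : w = -2 := by
  rw [norm_eq_one_iff', add_re, add_im, one_re, one_im, add_zero] at h₁
  rw [norm_eq_two_iff] at h₂
  have hre : w.re = -2 := by nlinarith
  have him : w.im = 0 := by nlinarith [sq_nonneg w.im]
  rw [eq_of_re_im hre him]; norm_num

/-- The two lake boundaries meet only at `0`. -/
theorem eq_zero_of_norms {w : ℂ} (h₁ : ‖w - 1‖ = 1) (h₂ : ‖w + 1‖ = 1) : w = 0 := by
  rw [norm_eq_one_iff', sub_re, sub_im, one_re, one_im, sub_zero] at h₁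
  rw [norm_eq_one_iff', add_re, add_im, one_re, one_im, add_zero] at h₂
  have hre : w.re = 0 := by nlinarith
  have him : w.im = 0 := by nlinarith [sq_nonneg w.im]
  rw [eq_of_re_im hre him]; norm_num

/-! ## §3 Preimages: the tangency points, and the three circles minus them -/

/-- Trichotomy of slots: big circle `[0,½]`, left lake `(⅝,⅞]`, right lake `(½,⅝] ∪ (⅞,1]`. -/
theorem slot_cases (t : unitInterval) : (t : ℝ) ≤ 1 / 2 ∨ (5 / 8 < (t : ℝ) ∧ (t : ℝ) ≤ 7 / 8) ∨
    ((1 / 2 < (t : ℝ) ∧ (t : ℝ) ≤ 5 / 8) ∨ 7 / 8 < (t : ℝ)) := by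
  by_cases h₁ : (t : ℝ) ≤ 1 / 2; · exact Or.inl h₁
  by_cases h₂ : (t : ℝ) ≤ 5 / 8; · exact Or.inr (Or.inr (Or.inl ⟨not_le.1 h₁, h₂⟩))
  by_cases h₃ : (t : ℝ) ≤ 7 / 8; · exact Or.inr (Or.inl ⟨not_le.1 h₂, h₃⟩)
  exact Or.inr (Or.inr (Or.inr (not_le.1 h₃)))

/-- `L t = 2` with `t < 1` forces `t ∈ {0, ½}`. -/
theorem eq_of_loop_eq_two (hU : ∀ t, U t = circleMap 0 2 (0 + (π - 0) * t)) (hD : ∀ t, D t = circleMap 0 2 (π + (2 * π - π) * t)) (ha : ∀ t, a t = circleMap (-1) 1 (π + (0 - π) * t)) (hb : ∀ t, b t = circleMap (-1) 1 (0 + (-π - 0) * t)) (hc : ∀ t, c t = circleMap 1 1 (π + (0 - π) * t)) (hd : ∀ t, d t = circleMap 1 1 (0 + (-π - 0) * t)) {t : unitInterval} (ht1 : (t : ℝ) < 1)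
    (h : ((U.trans D).trans ((d.trans b).trans (a.trans c))) t = 2) : (t : ℝ) = 0 ∨ (t : ℝ) = 1 / 2 := by
  rcases slot_cases t with ht | ⟨ht, ht'⟩ | (⟨ht, ht'⟩ | ht)
  · rcases eq_or_lt_of_le ht with e | lt
    · exact Or.inr e
    left
    rw [loop_apply_big hU hD ht, ← cm_big_zero] at h
    have := eq_of_circleMap_eq two_ne_zero (by rw [sub_zero, abs_lt]; constructor <;> nlinarith [Real.pi_pos, t.2.1, t.2.2]) h
    nlinarith [Real.pi_pos]
  · have := norm_loop_left (U := U) (D := D) (c := c) (d := d) ha hb ht ht'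
    rw [h] at this; norm_num at this
  · rw [loop_apply_d hd ht ht', ← cm_right_zero] at h
    have := eq_of_circleMap_eq one_ne_zero (by rw [sub_zero, abs_lt]; constructor <;> nlinarith [Real.pi_pos, t.2.1, t.2.2]) h
    exfalso; nlinarith [Real.pi_pos]
  · rw [loop_apply_c hc ht, ← cm_right_zero] at h
    have := eq_of_circleMap_eq one_ne_zero (by rw [sub_zero, abs_lt]; constructor <;> nlinarith [Real.pi_pos, t.2.1, t.2.2]) h
    exfalso; nlinarith [Real.pi_pos]

/-- `L t = −2` with `t < 1` forces `t ∈ {¼, ¾}`. -/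
theorem eq_of_loop_eq_neg_two (hU : ∀ t, U t = circleMap 0 2 (0 + (π - 0) * t)) (hD : ∀ t, D t = circleMap 0 2 (π + (2 * π - π) * t)) (ha : ∀ t, a t = circleMap (-1) 1 (π + (0 - π) * t)) (hb : ∀ t, b t = circleMap (-1) 1 (0 + (-π - 0) * t)) (hc : ∀ t, c t = circleMap 1 1 (π + (0 - π) * t)) (hd : ∀ t, d t = circleMap 1 1 (0 + (-π - 0) * t)) {t : unitInterval}
    (h : ((U.trans D).trans ((d.trans b).trans (a.trans c))) t = -2) : (t : ℝ) = 1 / 4 ∨ (t : ℝ) = 3 / 4 := by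
  rcases slot_cases t with ht | ⟨ht, ht'⟩ | hr
  · left
    rw [loop_apply_big hU hD ht, ← cm_big_pi] at h
    have := eq_of_circleMap_eq two_ne_zero (by rw [abs_lt]; constructor <;> nlinarith [Real.pi_pos, t.2.1, t.2.2]) h
    nlinarith [Real.pi_pos]
  · right
    by_cases h₃ : (t : ℝ) ≤ 3 / 4
    · rw [loop_apply_b hb ht h₃, ← cm_left_neg_pi] at h
      have := eq_of_circleMap_eq one_ne_zero (by rw [abs_lt]; constructor <;> nlinarith [Real.pi_pos, t.2.1, t.2.2]) h
      nlinarith [Real.pi_pos]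
    · rw [loop_apply_a ha (not_le.1 h₃) ht', ← cm_left_pi] at h
      have := eq_of_circleMap_eq one_ne_zero (by rw [abs_lt]; constructor <;> nlinarith [Real.pi_pos, t.2.1, t.2.2]) h
      exfalso; nlinarith [Real.pi_pos]
  · have := norm_loop_right (U := U) (D := D) (a := a) (b := b) hc hd hr
    rw [h] at this; norm_num at this

/-- `L t = 0` with `t < 1` forces `t ∈ {⅝, ⅞}`. -/
theorem eq_of_loop_eq_zero (hU : ∀ t, U t = circleMap 0 2 (0 + (π - 0) * t)) (hD : ∀ t, D t = circleMap 0 2 (π + (2 * π - π) * t)) (ha : ∀ t, a t = circleMap (-1) 1 (π + (0 - π) * t)) (hb : ∀ t, b t = circleMap (-1) 1 (0 + (-π - 0) * t)) (hc : ∀ t, c t = circleMap 1 1 (π + (0 - π) * t)) (hd : ∀ t, d t = circleMap 1 1 (0 + (-π - 0) * t)) {t : unitInterval}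
    (h : ((U.trans D).trans ((d.trans b).trans (a.trans c))) t = 0) : (t : ℝ) = 5 / 8 ∨ (t : ℝ) = 7 / 8 := by
  rcases slot_cases t with ht | ⟨ht, ht'⟩ | (⟨ht, ht'⟩ | ht)
  · have := norm_loop_big (a := a) (b := b) (c := c) (d := d) hU hD ht
    rw [h] at this; norm_num at this
  · by_cases h₃ : (t : ℝ) ≤ 3 / 4
    · rw [loop_apply_b hb ht h₃, ← cm_left_zero] at h
      have := eq_of_circleMap_eq one_ne_zero (by rw [sub_zero, abs_lt]; constructor <;> nlinarith [Real.pi_pos, t.2.1, t.2.2]) h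
      exfalso; nlinarith [Real.pi_pos]
    · right
      rw [loop_apply_a ha (not_le.1 h₃) ht', ← cm_left_zero] at h
      have := eq_of_circleMap_eq one_ne_zero (by rw [sub_zero, abs_lt]; constructor <;> nlinarith [Real.pi_pos, t.2.1, t.2.2]) h
      nlinarith [Real.pi_pos]
  · left
    rw [loop_apply_d hd ht ht', ← cm_right_neg_pi] at h
    have := eq_of_circleMap_eq one_ne_zero (by rw [abs_lt]; constructor <;> nlinarith [Real.pi_pos, t.2.1, t.2.2]) h
    nlinarith [Real.pi_pos]
  · rw [loop_apply_c hc ht, ← cm_right_pi] at h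
    have := eq_of_circleMap_eq one_ne_zero (by rw [abs_lt]; constructor <;> nlinarith [Real.pi_pos, t.2.1, t.2.2]) h
    exfalso; nlinarith [Real.pi_pos]

/-- Off the tangency points, a point of the big circle is hit only at times `< ½`, injectively. -/
theorem eq_of_loop_eq_of_big (hU : ∀ t, U t = circleMap 0 2 (0 + (π - 0) * t)) (hD : ∀ t, D t = circleMap 0 2 (π + (2 * π - π) * t)) (ha : ∀ t, a t = circleMap (-1) 1 (π + (0 - π) * t)) (hb : ∀ t, b t = circleMap (-1) 1 (0 + (-π - 0) * t)) (hc : ∀ t, c t = circleMap 1 1 (π + (0 - π) * t)) (hd : ∀ t, d t = circleMap 1 1 (0 + (-π - 0) * t)) {s t : unitInterval}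
    (hw : ‖((U.trans D).trans ((d.trans b).trans (a.trans c))) s‖ = 2) (h2 : ((U.trans D).trans ((d.trans b).trans (a.trans c))) s ≠ 2) (hm2 : ((U.trans D).trans ((d.trans b).trans (a.trans c))) s ≠ -2) (h : ((U.trans D).trans ((d.trans b).trans (a.trans c))) s = ((U.trans D).trans ((d.trans b).trans (a.trans c))) t) : s = t := by
  have loc : ∀ r : unitInterval, ‖((U.trans D).trans ((d.trans b).trans (a.trans c))) r‖ = 2 → ((U.trans D).trans ((d.trans b).trans (a.trans c))) r ≠ 2 → ((U.trans D).trans ((d.trans b).trans (a.trans c))) r ≠ -2 → (r : ℝ) < 1 / 2 := by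
    intro r hr hr2 hrm2
    rcases slot_cases r with hr' | ⟨h₁, h₂⟩ | hr'
    · refine lt_of_le_of_ne hr' fun e ↦ hr2 ?_
      rw [loop_apply_big hU hD hr', e, ← cm_big_two_pi]; congr 1; ring
    · exact absurd (eq_neg_two_of_norms (norm_loop_left (U := U) (D := D) (c := c) (d := d) ha hb h₁ h₂) hr) hrm2
    · exact absurd (eq_two_of_norms (norm_loop_right (U := U) (D := D) (a := a) (b := b) hc hd hr') hr) hr2
  have hs := loc s hw h2 hm2
  have ht := loc t (h ▸ hw) (h ▸ h2) (h ▸ hm2)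
  rw [loop_apply_big hU hD hs.le, loop_apply_big hU hD ht.le] at h
  have := eq_of_circleMap_eq two_ne_zero (by rw [abs_lt]; constructor <;> nlinarith [Real.pi_pos, s.2.1, t.2.1]) h
  exact Subtype.ext (by nlinarith [Real.pi_pos])

/-- Off the tangency points, a point of the left lake boundary is hit only in `(⅝, ⅞]`, injectively. -/
theorem eq_of_loop_eq_of_left (hU : ∀ t, U t = circleMap 0 2 (0 + (π - 0) * t)) (hD : ∀ t, D t = circleMap 0 2 (π + (2 * π - π) * t)) (ha : ∀ t, a t = circleMap (-1) 1 (π + (0 - π) * t)) (hb : ∀ t, b t = circleMap (-1) 1 (0 + (-π - 0) * t)) (hc : ∀ t, c t = circleMap 1 1 (π + (0 - π) * t)) (hd : ∀ t, d t = circleMap 1 1 (0 + (-π - 0) * t)) {s t : unitInterval}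
    (hw : ‖((U.trans D).trans ((d.trans b).trans (a.trans c))) s + 1‖ = 1) (hm2 : ((U.trans D).trans ((d.trans b).trans (a.trans c))) s ≠ -2) (h0 : ((U.trans D).trans ((d.trans b).trans (a.trans c))) s ≠ 0) (h : ((U.trans D).trans ((d.trans b).trans (a.trans c))) s = ((U.trans D).trans ((d.trans b).trans (a.trans c))) t) : s = t := by
  have loc : ∀ r : unitInterval, ‖((U.trans D).trans ((d.trans b).trans (a.trans c))) r + 1‖ = 1 → ((U.trans D).trans ((d.trans b).trans (a.trans c))) r ≠ -2 → ((U.trans D).trans ((d.trans b).trans (a.trans c))) r ≠ 0 →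
      5 / 8 < (r : ℝ) ∧ (r : ℝ) ≤ 7 / 8 := by
    intro r hr hrm2 hr0
    rcases slot_cases r with hr' | hr' | hr'
    · exact absurd (eq_neg_two_of_norms hr (norm_loop_big (a := a) (b := b) (c := c) (d := d) hU hD hr')) hrm2
    · exact hr'
    · exact absurd (eq_zero_of_norms (norm_loop_right (U := U) (D := D) (a := a) (b := b) hc hd hr') hr) hr0
  -- the angle `θ r ∈ [-π, π)` of `L r + 1`
  have ang : ∀ r : unitInterval, 5 / 8 < (r : ℝ) → (r : ℝ) ≤ 7 / 8 → ∃ θ : ℝ, -π ≤ θ ∧ θ < π ∧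
      ((U.trans D).trans ((d.trans b).trans (a.trans c))) r = circleMap (-1) 1 θ ∧ ((θ < 0 ∧ θ = -(π * (8 * r - 5))) ∨ (0 ≤ θ ∧ θ = π - π * (8 * r - 6))) := by
    intro r h₁ h₂
    by_cases h₃ : (r : ℝ) ≤ 3 / 4
    · refine ⟨_, ?_, ?_, loop_apply_b hb h₁ h₃, Or.inl ⟨?_, rfl⟩⟩ <;> nlinarith [Real.pi_pos]
    · refine ⟨_, ?_, ?_, loop_apply_a ha (not_le.1 h₃) h₂, Or.inr ⟨?_, rfl⟩⟩ <;> nlinarith [Real.pi_pos]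
  obtain ⟨hs₁, hs₂⟩ := loc s hw hm2 h0
  obtain ⟨ht₁, ht₂⟩ := loc t (h ▸ hw) (h ▸ hm2) (h ▸ h0)
  obtain ⟨θ, hθ₁, hθ₂, hLs, hθ⟩ := ang s hs₁ hs₂
  obtain ⟨φ, hφ₁, hφ₂, hLt, hφ⟩ := ang t ht₁ ht₂
  rw [hLs, hLt] at h
  have e := eq_of_circleMap_eq one_ne_zero (by rw [abs_lt]; constructor <;> linarith) h
  subst e
  apply Subtype.ext
  rcases hθ with ⟨h₁, h₂⟩ | ⟨h₁, h₂⟩ <;> rcases hφ with ⟨h₃, h₄⟩ | ⟨h₃, h₄⟩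
  · nlinarith [Real.pi_pos]
  · exact absurd h₁ (not_lt.2 h₃)
  · exact absurd h₃ (not_lt.2 h₁)
  · nlinarith [Real.pi_pos]

/-- Off the tangency points, a point of the right lake boundary is hit only in `(½, ⅝] ∪ (⅞, 1]`,
injectively. -/
theorem eq_of_loop_eq_of_right (hU : ∀ t, U t = circleMap 0 2 (0 + (π - 0) * t)) (hD : ∀ t, D t = circleMap 0 2 (π + (2 * π - π) * t)) (ha : ∀ t, a t = circleMap (-1) 1 (π + (0 - π) * t)) (hb : ∀ t, b t = circleMap (-1) 1 (0 + (-π - 0) * t)) (hc : ∀ t, c t = circleMap 1 1 (π + (0 - π) * t)) (hd : ∀ t, d t = circleMap 1 1 (0 + (-π - 0) * t)) {s t : unitInterval}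
    (hw : ‖((U.trans D).trans ((d.trans b).trans (a.trans c))) s - 1‖ = 1) (h2 : ((U.trans D).trans ((d.trans b).trans (a.trans c))) s ≠ 2) (h0 : ((U.trans D).trans ((d.trans b).trans (a.trans c))) s ≠ 0) (h : ((U.trans D).trans ((d.trans b).trans (a.trans c))) s = ((U.trans D).trans ((d.trans b).trans (a.trans c))) t) : s = t := by
  have loc : ∀ r : unitInterval, ‖((U.trans D).trans ((d.trans b).trans (a.trans c))) r - 1‖ = 1 → ((U.trans D).trans ((d.trans b).trans (a.trans c))) r ≠ 2 → ((U.trans D).trans ((d.trans b).trans (a.trans c))) r ≠ 0 →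
      (1 / 2 < (r : ℝ) ∧ (r : ℝ) ≤ 5 / 8) ∨ 7 / 8 < (r : ℝ) := by
    intro r hr hr2 hr0
    rcases slot_cases r with hr' | ⟨h₁, h₂⟩ | hr'
    · exact absurd (eq_two_of_norms hr (norm_loop_big (a := a) (b := b) (c := c) (d := d) hU hD hr')) hr2
    · exact absurd (eq_zero_of_norms hr (norm_loop_left (U := U) (D := D) (c := c) (d := d) ha hb h₁ h₂)) hr0
    · exact hr'
  -- the angle `θ r ∈ [-π, π)` of `L r - 1`
  have ang : ∀ r : unitInterval, (1 / 2 < (r : ℝ) ∧ (r : ℝ) ≤ 5 / 8) ∨ 7 / 8 < (r : ℝ) → ∃ θ : ℝ, -π ≤ θ ∧ θ < π ∧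
      ((U.trans D).trans ((d.trans b).trans (a.trans c))) r = circleMap 1 1 θ ∧ ((θ < 0 ∧ θ = -(π * (8 * r - 4))) ∨ (0 ≤ θ ∧ θ = π - π * (8 * r - 7))) := by
    rintro r (⟨h₁, h₂⟩ | h₁)
    · refine ⟨_, ?_, ?_, loop_apply_d hd h₁ h₂, Or.inl ⟨?_, rfl⟩⟩ <;> nlinarith [Real.pi_pos]
    · refine ⟨_, ?_, ?_, loop_apply_c hc h₁, Or.inr ⟨?_, rfl⟩⟩ <;> nlinarith [Real.pi_pos, r.2.2]
  have hs := loc s hw h2 h0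
  have ht := loc t (h ▸ hw) (h ▸ h2) (h ▸ h0)
  obtain ⟨θ, hθ₁, hθ₂, hLs, hθ⟩ := ang s hs
  obtain ⟨φ, hφ₁, hφ₂, hLt, hφ⟩ := ang t ht
  rw [hLs, hLt] at h
  have e := eq_of_circleMap_eq one_ne_zero (by rw [abs_lt]; constructor <;> linarith) h
  subst e
  apply Subtype.ext
  rcases hθ with ⟨h₁, h₂⟩ | ⟨h₁, h₂⟩ <;> rcases hφ with ⟨h₃, h₄⟩ | ⟨h₃, h₄⟩
  · nlinarith [Real.pi_pos]
  · exact absurd h₁ (not_lt.2 h₃)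
  · exact absurd h₃ (not_lt.2 h₁)
  · nlinarith [Real.pi_pos]

/-! ## §4 At most double points -/

/-- Three values in a two-element set: two of them coincide. -/
theorem two_of_three {x y z p q : ℝ} (hx : x = p ∨ x = q) (hy : y = p ∨ y = q) (hz : z = p ∨ z = q) :
    x = y ∨ y = z ∨ x = z := by
  rcases hx with rfl | rfl <;> rcases hy with rfl | rfl <;> rcases hz with rfl | rfl <;> simp

/-- **The two-mouth-lake loop has at most double points**: among three times `< 1` with the same image, two
coincide (the `Tame.atMostDouble` clause). -/
theorem atMostDouble_loop (hU : ∀ t, U t = circleMap 0 2 (0 + (π - 0) * t)) (hD : ∀ t, D t = circleMap 0 2 (π + (2 * π - π) * t)) (ha : ∀ t, a t = circleMap (-1) 1 (π + (0 - π) * t)) (hb : ∀ t, b t = circleMap (-1) 1 (0 + (-π - 0) * t)) (hc : ∀ t, c t = circleMap 1 1 (π + (0 - π) * t)) (hd : ∀ t, d t = circleMap 1 1 (0 + (-π - 0) * t)) (t₁ t₂ t₃ : unitInterval) (h₁ : t₁ < 1)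
    (h₂ : t₂ < 1) (h₃ : t₃ < 1) (e₁₂ : ((U.trans D).trans ((d.trans b).trans (a.trans c))) t₁ = ((U.trans D).trans ((d.trans b).trans (a.trans c))) t₂) (e₂₃ : ((U.trans D).trans ((d.trans b).trans (a.trans c))) t₂ = ((U.trans D).trans ((d.trans b).trans (a.trans c))) t₃) :
    t₁ = t₂ ∨ t₂ = t₃ ∨ t₁ = t₃ := by
  have h₁' : (t₁ : ℝ) < 1 := h₁
  have h₂' : (t₂ : ℝ) < 1 := h₂
  have h₃' : (t₃ : ℝ) < 1 := h₃
  have lift : ((t₁ : ℝ) = t₂ ∨ (t₂ : ℝ) = t₃ ∨ (t₁ : ℝ) = t₃) → t₁ = t₂ ∨ t₂ = t₃ ∨ t₁ = t₃ := by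
    rintro (h | h | h)
    exacts [Or.inl (Subtype.ext h), Or.inr (Or.inl (Subtype.ext h)), Or.inr (Or.inr (Subtype.ext h))]
  set w := ((U.trans D).trans ((d.trans b).trans (a.trans c))) t₁ with hw
  by_cases hw2 : w = 2
  · exact lift (two_of_three (eq_of_loop_eq_two hU hD ha hb hc hd h₁' hw2)
      (eq_of_loop_eq_two hU hD ha hb hc hd h₂' (e₁₂ ▸ hw2))
      (eq_of_loop_eq_two hU hD ha hb hc hd h₃' (e₂₃ ▸ e₁₂ ▸ hw2)))
  by_cases hwm2 : w = -2
  · exact lift (two_of_three (eq_of_loop_eq_neg_two hU hD ha hb hc hd hwm2)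
      (eq_of_loop_eq_neg_two hU hD ha hb hc hd (e₁₂ ▸ hwm2))
      (eq_of_loop_eq_neg_two hU hD ha hb hc hd (e₂₃ ▸ e₁₂ ▸ hwm2)))
  by_cases hw0 : w = 0
  · exact lift (two_of_three (eq_of_loop_eq_zero hU hD ha hb hc hd hw0)
      (eq_of_loop_eq_zero hU hD ha hb hc hd (e₁₂ ▸ hw0))
      (eq_of_loop_eq_zero hU hD ha hb hc hd (e₂₃ ▸ e₁₂ ▸ hw0)))
  -- `w` lies on exactly one circle
  have hT : w ∈ sphere (0 : ℂ) 2 ∪ sphere (-1) 1 ∪ sphere 1 1 := by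
    rw [hw, ← range_loop hU hD ha hb hc hd]; exact ⟨t₁, rfl⟩
  rw [mem_trace_iff] at hT
  left
  rcases hT with h | h | h
  · exact eq_of_loop_eq_of_big hU hD ha hb hc hd h hw2 hwm2 e₁₂
  · exact eq_of_loop_eq_of_left hU hD ha hb hc hd h hwm2 hw0 e₁₂
  · exact eq_of_loop_eq_of_right hU hD ha hb hc hd h hw2 hw0 e₁₂

end Loop

end TwoMouth

open TwoMouth in
/-- **Anchor (registered): the two-mouth-lake loop, with at most double points** — a Mathlib loop
`γ : Path 2 2` with trace the three circles `|z| = 2`, `|z ± 1| = 1`, winding number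
`𝟙[|z| < 2 ∧ |z + 1| > 1 ∧ |z − 1| > 1]` everywhere, and no point visited three times before time `1`
(the `Tame.atMostDouble` clause of the witness refuting `tame_rigidity`). -/
theorem exists_twoMouthLoop_atMostDouble : ∃ γ : Path (2 : ℂ) 2,
    Set.range γ = Metric.sphere 0 2 ∪ Metric.sphere (-1) 1 ∪ Metric.sphere 1 1 ∧
      (∀ z, (Curve.ofPath γ).wind z = if ‖z‖ < 2 ∧ 1 < ‖z + 1‖ ∧ 1 < ‖z - 1‖ then 1 else 0) ∧
      ∀ t₁ t₂ t₃ : unitInterval, t₁ < 1 → t₂ < 1 → t₃ < 1 → γ t₁ = γ t₂ → γ t₂ = γ t₃ →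
        t₁ = t₂ ∨ t₂ = t₃ ∨ t₁ = t₃ := by
  obtain ⟨U, D, a, b, c, d, hU, hD, ha, hb, hc, hd⟩ := exists_arcs
  exact ⟨_, range_loop hU hD ha hb hc hd, wind_loop hU hD ha hb hc hd, atMostDouble_loop hU hD ha hb hc hd⟩

end Summit.CriticalPhenomena.CardyFormulaZ2.Cruxes.NestingRigidity.PositiveConeWeightDoubling

end
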